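import Summits.CriticalPhenomena.SAWScalingLimit.Theorems.SAWWeldingIdentificationWeldingLawOfLimitStableNecessity

/-!
# The `stable_proxies` cut of `WeldingLawOfLimit` is sound and complete (stmt-4502)

Route `SAWWeldingIdentification` of `CriticalPhenomena/SAWScalingLimit`, crux (W)
`WeldingLawOfLimit` (stmt-CriticalPhenomena-4502), line `registered` = skeleton
`Cruxes/WeldingLawOfLimit/Lines/stable_proxies.lean` (lead c12). The skeleton's stubs are
stub 1 = stmt-4982 `SimpleSubseqLimits`, Stub A `StableChordProxies` (welding-stable chord proxies
exist) and Stub B `WeldingLawOfStableProxies` (every welding-stable chord-proxy family carries the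
SLE_{8/3} welding marginals); all statements below are the skeleton's, with its abbreviations
`IsChordProxy` / `IsWeldingStable` / `HasSLEWeldingLaw` unfolded (the Cruxes file is not importable).

* `tendsto_measureReal_lt_abs_sub_welding`, `hasSLEWeldingLaw_transfer` — the skeleton's transfer
  lemma, brought under `Theorems/`: the SLE_{8/3} welding law passes from one chord-proxy family to
  every welding-STABLE chord-proxy family of the same walks (coordinatewise stability estimate, sup
  metric on `ℝᵏ`, converging together `tendsto_integral_comp_of_tendsto_measureReal_lt_dist`).
* `weldingLawOfStableProxies_of_sawScalingLimit` — Stub B follows from the conjunct.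
* `weldingLawOfLimit_of_simpleSubseqLimits_of_stableProxies` — the skeleton composition
  `stub 1 → A → B → (W)` at `Theorems/` level (so the closing file is one line once A, B land).
* `sawScalingLimit_iff_stableProxiesStubs` — **`SAWScalingLimit ⟺ 4982 ∧ 1372 ∧ A ∧ B`**,
  unconditionally; `weldingLawOfLimit_iff_stableProxiesStubs_of_eventualTight` — given stmt-1372,
  `(W) ⟺ 4982 ∧ A ∧ B`. So the cut is SOUND (each stub ⟸ conjunct) and COMPLETE (stubs ⇒ crux).

References: Billingsley (1999) Thm 3.1 (converging together). Transfer lemma adapted from the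
strategist's skeleton `Lines/stable_proxies.lean` (planner cstrat-r1, 2026-08-17). No new
definition, no named fact.
-/

noncomputable section

open MeasureTheory Filter Topology Set
open scoped NNReal ENNReal BoundedContinuousFunction
open Literature.Probability.RandomPlanarGeometry Literature.Probability.LatticeModels
open Literature.Probability.Process (preWienerMeasure)
open Summit.CriticalPhenomena.SAWScalingLimit.Theses

namespace Summit.CriticalPhenomena.SAWScalingLimit.Theorems.WeldingLawOfLimit

section Transfer

variable {Q : ConformalRectangle} {δs : ℕ → ℝ} {a b : ℝ → Site 2}
  {c c' : (n : ℕ) → SAW.DomainSAW Q.carrier (δs n) (a (δs n)) (b (δs n)) → CurveClass ℂ}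

/-- **The stability estimate, one coordinate.** If `c`, `c'` are eventually a.s. simple chords,
both close to the walk in probability, and `c'` is welding-stable, then for `x > 0`, `ε > 0` the
probability that the canonical weldings of `cₙ ω` and `c'ₙ ω` at `x` differ by more than `ε` tends
to `0` (off the stability event, `cₙ ω` is a simple chord within `ρ` of `c'ₙ ω`). [folklore] -/
theorem tendsto_measureReal_lt_abs_sub_welding
    (hcS : ∀ᶠ n in atTop, ∀ᵐ ω ∂(SAW.law Q.carrier (δs n) (a (δs n)) (b (δs n))),
      (Q.chord 0 2 (by decide)).IsSimpleChord (c n ω))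
    (hcd : ∀ ε : ℝ, 0 < ε → Tendsto (fun n => (SAW.law Q.carrier (δs n) (a (δs n)) (b (δs n))).real
      {ω | ε < dist ω.curve (c n ω)}) atTop (𝓝 0))
    (hc'd : ∀ ε : ℝ, 0 < ε → Tendsto (fun n => (SAW.law Q.carrier (δs n) (a (δs n)) (b (δs n))).real
      {ω | ε < dist ω.curve (c' n ω)}) atTop (𝓝 0))
    (hst : ∀ x : ℝ, 0 < x → ∀ ε : ℝ, 0 < ε → ∀ η : ℝ, 0 < η → ∃ ρ : ℝ, 0 < ρ ∧
      ∀ᶠ n in atTop, (SAW.law Q.carrier (δs n) (a (δs n)) (b (δs n))).real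
        {ω | ∃ γ' : CurveClass ℂ, (Q.chord 0 2 (by decide)).IsSimpleChord γ' ∧
          dist γ' (c' n ω) < ρ ∧
          ε ≤ |conformalWelding Q γ' x - conformalWelding Q (c' n ω) x|} ≤ η)
    {x : ℝ} (hx : 0 < x) {ε : ℝ} (hε : 0 < ε) :
    Tendsto (fun n => (SAW.law Q.carrier (δs n) (a (δs n)) (b (δs n))).real
      {ω | ε < |conformalWelding Q (c n ω) x - conformalWelding Q (c' n ω) x|}) atTop (𝓝 0) := by
  -- adapted from the skeleton Lines/stable_proxies.lean (planner cstrat-r1)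
  rw [Metric.tendsto_nhds]
  intro η hη
  obtain ⟨ρ, hρ, hbad⟩ := hst x hx ε hε (η / 3) (by positivity)
  have hρ3 : 0 < ρ / 3 := by positivity
  have h1 := hcd (ρ / 3) hρ3
  have h2 := hc'd (ρ / 3) hρ3
  rw [Metric.tendsto_nhds] at h1 h2
  filter_upwards [hbad, h1 (η / 3) (by positivity), h2 (η / 3) (by positivity), hcS]
    with n hbadn h1n h2n hchn
  set μ : Measure (SAW.DomainSAW Q.carrier (δs n) (a (δs n)) (b (δs n))) :=
    SAW.law Q.carrier (δs n) (a (δs n)) (b (δs n)) with hμ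
  haveI : IsFiniteMeasure μ := isFiniteMeasure_sawLaw _ _ _ _
  set S := {ω : SAW.DomainSAW Q.carrier (δs n) (a (δs n)) (b (δs n)) |
      ε < |conformalWelding Q (c n ω) x - conformalWelding Q (c' n ω) x|} with hS
  set B := {ω : SAW.DomainSAW Q.carrier (δs n) (a (δs n)) (b (δs n)) |
      ∃ γ' : CurveClass ℂ, (Q.chord 0 2 (by decide)).IsSimpleChord γ' ∧ dist γ' (c' n ω) < ρ ∧
        ε ≤ |conformalWelding Q γ' x - conformalWelding Q (c' n ω) x|} with hB
  set A₁ := {ω : SAW.DomainSAW Q.carrier (δs n) (a (δs n)) (b (δs n)) |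
      ρ / 3 < dist ω.curve (c n ω)} with hA₁
  set A₂ := {ω : SAW.DomainSAW Q.carrier (δs n) (a (δs n)) (b (δs n)) |
      ρ / 3 < dist ω.curve (c' n ω)} with hA₂
  set N := {ω : SAW.DomainSAW Q.carrier (δs n) (a (δs n)) (b (δs n)) |
      ¬ (Q.chord 0 2 (by decide)).IsSimpleChord (c n ω)} with hN
  have hsub : S ⊆ ((B ∪ A₁) ∪ A₂) ∪ N := by
    intro ω hω
    by_cases hch : (Q.chord 0 2 (by decide)).IsSimpleChord (c n ω)
    · by_cases hd : dist (c n ω) (c' n ω) < ρ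
      · exact Or.inl (Or.inl (Or.inl ⟨c n ω, hch, hd, le_of_lt hω⟩))
      · have htri : dist (c n ω) (c' n ω) ≤ dist ω.curve (c n ω) + dist ω.curve (c' n ω) :=
          calc dist (c n ω) (c' n ω) ≤ dist (c n ω) ω.curve + dist ω.curve (c' n ω) :=
                dist_triangle _ _ _
            _ = dist ω.curve (c n ω) + dist ω.curve (c' n ω) := by rw [dist_comm (c n ω)]
        have hρle : ρ ≤ dist ω.curve (c n ω) + dist ω.curve (c' n ω) := (not_lt.1 hd).trans htri
        by_cases h₁ : ρ / 3 < dist ω.curve (c n ω)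
        · exact Or.inl (Or.inl (Or.inr h₁))
        · have h₂ : ρ / 3 < dist ω.curve (c' n ω) := by
            have := not_lt.1 h₁
            linarith
          exact Or.inl (Or.inr h₂)
    · exact Or.inr hch
  have hN0 : μ.real N = 0 := by
    rw [measureReal_def, show μ N = 0 from ae_iff.1 hchn, ENNReal.toReal_zero]
  have hA₁' : μ.real A₁ < η / 3 := by
    have := h1n
    rwa [Real.dist_eq, sub_zero, abs_of_nonneg measureReal_nonneg] at this
  have hA₂' : μ.real A₂ < η / 3 := by
    have := h2n
    rwa [Real.dist_eq, sub_zero, abs_of_nonneg measureReal_nonneg] at this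
  have hmono : μ.real S ≤ μ.real (((B ∪ A₁) ∪ A₂) ∪ N) := measureReal_mono hsub
  have hu1 : μ.real (((B ∪ A₁) ∪ A₂) ∪ N) ≤ μ.real ((B ∪ A₁) ∪ A₂) + μ.real N :=
    measureReal_union_le _ _
  have hu2 : μ.real ((B ∪ A₁) ∪ A₂) ≤ μ.real (B ∪ A₁) + μ.real A₂ := measureReal_union_le _ _
  have hu3 : μ.real (B ∪ A₁) ≤ μ.real B + μ.real A₁ := measureReal_union_le _ _
  rw [Real.dist_eq, sub_zero, abs_of_nonneg measureReal_nonneg]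
  linarith

/-- **Transfer of the welding law along stable families** (the skeleton's
`HasSLEWeldingLaw.transfer`): if a chord-proxy family `c` carries the SLE_{8/3} welding marginals,
then so does every welding-STABLE chord-proxy family `c'` of the same walks — the welding vectors
of `c` and `c'` at `x₁, …, x_k` are `ε`-close in probability (stability, coordinatewise, sup metric
on `ℝᵏ`), so the laws converge together (Billingsley 1999 Thm 3.1, tree:
`tendsto_integral_comp_of_tendsto_measureReal_lt_dist`). [folklore] -/
theorem hasSLEWeldingLaw_transfer
    (hlaw : ∀ Γ : (NNReal → ℝ) → CurveClass ℂ,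
      IsSLECurve ((8 : NNReal) / 3) (Q.chord 0 2 (by decide)) Γ →
      ∀ (k : ℕ) (x : Fin k → ℝ), (∀ i, 0 < x i) → ∀ g : BoundedContinuousFunction (Fin k → ℝ) ℝ,
        Tendsto (fun n => ∫ ω, g (fun i => conformalWelding Q (c n ω) (x i))
          ∂(SAW.law Q.carrier (δs n) (a (δs n)) (b (δs n)))) atTop
          (𝓝 (∫ γ, g (fun i => conformalWelding Q γ (x i)) ∂(preWienerMeasure.map Γ))))
    (hcS : ∀ᶠ n in atTop, ∀ᵐ ω ∂(SAW.law Q.carrier (δs n) (a (δs n)) (b (δs n))),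
      (Q.chord 0 2 (by decide)).IsSimpleChord (c n ω))
    (hcd : ∀ ε : ℝ, 0 < ε → Tendsto (fun n => (SAW.law Q.carrier (δs n) (a (δs n)) (b (δs n))).real
      {ω | ε < dist ω.curve (c n ω)}) atTop (𝓝 0))
    (hc'd : ∀ ε : ℝ, 0 < ε → Tendsto (fun n => (SAW.law Q.carrier (δs n) (a (δs n)) (b (δs n))).real
      {ω | ε < dist ω.curve (c' n ω)}) atTop (𝓝 0))
    (hst : ∀ x : ℝ, 0 < x → ∀ ε : ℝ, 0 < ε → ∀ η : ℝ, 0 < η → ∃ ρ : ℝ, 0 < ρ ∧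
      ∀ᶠ n in atTop, (SAW.law Q.carrier (δs n) (a (δs n)) (b (δs n))).real
        {ω | ∃ γ' : CurveClass ℂ, (Q.chord 0 2 (by decide)).IsSimpleChord γ' ∧
          dist γ' (c' n ω) < ρ ∧
          ε ≤ |conformalWelding Q γ' x - conformalWelding Q (c' n ω) x|} ≤ η) :
    ∀ Γ : (NNReal → ℝ) → CurveClass ℂ,
      IsSLECurve ((8 : NNReal) / 3) (Q.chord 0 2 (by decide)) Γ →
      ∀ (k : ℕ) (x : Fin k → ℝ), (∀ i, 0 < x i) → ∀ g : BoundedContinuousFunction (Fin k → ℝ) ℝ,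
        Tendsto (fun n => ∫ ω, g (fun i => conformalWelding Q (c' n ω) (x i))
          ∂(SAW.law Q.carrier (δs n) (a (δs n)) (b (δs n)))) atTop
          (𝓝 (∫ γ, g (fun i => conformalWelding Q γ (x i)) ∂(preWienerMeasure.map Γ))) := by
  -- adapted from the skeleton Lines/stable_proxies.lean (planner cstrat-r1)
  intro Γ hΓ k x hx g
  haveI : IsProbabilityMeasure preWienerMeasure := isProbabilityMeasure_preWienerMeasure'
  haveI : IsProbabilityMeasure (preWienerMeasure.map Γ) := Measure.isProbabilityMeasure_map hΓ.1
  have hVm : Measurable fun (γ : CurveClass ℂ) (i : Fin k) => conformalWelding Q γ (x i) :=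
    measurable_pi_lambda _ fun i => measurable_conformalWelding Q (x i)
  set ν : Measure (Fin k → ℝ) :=
    (preWienerMeasure.map Γ).map (fun γ (i : Fin k) => conformalWelding Q γ (x i)) with hν
  haveI : IsProbabilityMeasure ν := Measure.isProbabilityMeasure_map hVm.aemeasurable
  set μ : (n : ℕ) → Measure (SAW.DomainSAW Q.carrier (δs n) (a (δs n)) (b (δs n))) :=
    fun n => SAW.law Q.carrier (δs n) (a (δs n)) (b (δs n)) with hμdef
  set X : (n : ℕ) → SAW.DomainSAW Q.carrier (δs n) (a (δs n)) (b (δs n)) → (Fin k → ℝ) :=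
    fun n ω i => conformalWelding Q (c n ω) (x i) with hXdef
  set Y : (n : ℕ) → SAW.DomainSAW Q.carrier (δs n) (a (δs n)) (b (δs n)) → (Fin k → ℝ) :=
    fun n ω i => conformalWelding Q (c' n ω) (x i) with hYdef
  -- the laws are eventually probability measures (mass `0` or `1`, and the `g ≡ 1` marginal → 1)
  have hμ : ∀ᶠ n in atTop, IsProbabilityMeasure (μ n) := by
    have h1 := hlaw Γ hΓ 0 (fun _ => 1) (fun _ => one_pos) 1
    simp only [BoundedContinuousFunction.coe_one, Pi.one_apply, integral_const, smul_eq_mul,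
      mul_one, probReal_univ] at h1
    filter_upwards [h1.eventually (lt_mem_nhds (show (1 : ℝ) / 2 < 1 by norm_num))] with n hn
    rcases SubseqIdentification.Negative.isProbabilityMeasure_law_or_eq_zero Q.carrier (δs n)
      (a (δs n)) (b (δs n)) with h | h
    · exact h
    · exfalso
      rw [h, measureReal_def, Measure.coe_zero, Pi.zero_apply, ENNReal.toReal_zero] at hn
      norm_num at hn
  have hlimX : ∀ f : (Fin k → ℝ) →ᵇ ℝ,
      Tendsto (fun n => ∫ ω, f (X n ω) ∂μ n) atTop (𝓝 (∫ y, f y ∂ν)) := by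
    intro f
    have e : ∫ y, f y ∂ν = ∫ γ, f (fun i => conformalWelding Q γ (x i)) ∂(preWienerMeasure.map Γ) :=
      integral_map hVm.aemeasurable f.continuous.aestronglyMeasurable
    rw [e]
    exact hlaw Γ hΓ k x hx f
  have hd : ∀ ε : ℝ, 0 < ε →
      Tendsto (fun n => (μ n).real {ω | ε < dist (X n ω) (Y n ω)}) atTop (𝓝 0) := by
    intro ε hε
    have hsub : ∀ n, {ω | ε < dist (X n ω) (Y n ω)} ⊆
        ⋃ i : Fin k, {ω | ε < |conformalWelding Q (c n ω) (x i) - conformalWelding Q (c' n ω) (x i)|} := by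
      intro n ω hω
      by_contra hcon
      simp only [mem_iUnion, mem_setOf_eq, not_exists, not_lt] at hcon
      have hle : dist (X n ω) (Y n ω) ≤ ε :=
        (dist_pi_le_iff hε.le).2 fun i => by rw [Real.dist_eq]; exact hcon i
      exact (lt_irrefl ε) (lt_of_lt_of_le hω hle)
    have hbound : ∀ n, (μ n).real {ω | ε < dist (X n ω) (Y n ω)} ≤
        ∑ i : Fin k, (μ n).real
          {ω | ε < |conformalWelding Q (c n ω) (x i) - conformalWelding Q (c' n ω) (x i)|} := by
      intro n
      haveI : IsFiniteMeasure (μ n) := isFiniteMeasure_sawLaw _ _ _ _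
      exact (measureReal_mono (hsub n)).trans (measureReal_iUnion_fintype_le _)
    have hsum : Tendsto (fun n => ∑ i : Fin k, (μ n).real
        {ω | ε < |conformalWelding Q (c n ω) (x i) - conformalWelding Q (c' n ω) (x i)|})
        atTop (𝓝 0) := by
      have h := tendsto_finsetSum (Finset.univ : Finset (Fin k))
        (fun i _ => tendsto_measureReal_lt_abs_sub_welding hcS hcd hc'd hst (hx i) hε)
      simpa using h
    exact squeeze_zero (fun n => measureReal_nonneg) hbound hsum
  have key := tendsto_integral_comp_of_tendsto_measureReal_lt_dist (l := atTop)
    (μ := μ) hμ (X := X) (Y := Y)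
    (Eventually.of_forall fun n => (SAW.DomainSAW.measurable_of_top _).aemeasurable)
    (Eventually.of_forall fun n => (SAW.DomainSAW.measurable_of_top _).aemeasurable) ν hlimX hd g
  have e : ∫ y, g y ∂ν = ∫ γ, g (fun i => conformalWelding Q γ (x i)) ∂(preWienerMeasure.map Γ) :=
    integral_map hVm.aemeasurable g.continuous.aestronglyMeasurable
  rw [e] at key
  exact key

end Transfer

/-! ### Stub B is necessary; the cut is sound and complete -/

/-- **Stub B `WeldingLawOfStableProxies` follows from the conjunct `SAWScalingLimit`** (signature
verbatim, unfolded): the conjunct gives a chord-proxy family with the SLE_{8/3} welding law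
(`latticeWeldingLaw_of_sawScalingLimit'`), which transfers to every stable family
(`hasSLEWeldingLaw_transfer`). [folklore] -/
theorem weldingLawOfStableProxies_of_sawScalingLimit (hS : _root_.SAWScalingLimit) :
    ∀ (Q : ConformalRectangle) (a b : ℝ → Site 2),
      SAW.IsEndpointApprox (Q.chord 0 2 (by decide)) a b →
      ∀ (δs : ℕ → ℝ), (∀ n, 0 < δs n) → Tendsto δs atTop (𝓝 0) →
      ∀ c : (n : ℕ) → SAW.DomainSAW Q.carrier (δs n) (a (δs n)) (b (δs n)) → CurveClass ℂ,
        ((∀ᶠ n in atTop, ∀ᵐ ω ∂(SAW.law Q.carrier (δs n) (a (δs n)) (b (δs n))),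
            (Q.chord 0 2 (by decide)).IsSimpleChord (c n ω)) ∧
         (∀ ε : ℝ, 0 < ε →
            Tendsto (fun n => (SAW.law Q.carrier (δs n) (a (δs n)) (b (δs n))).real
              {ω | ε < dist ω.curve (c n ω)}) atTop (𝓝 0))) →
        (∀ x : ℝ, 0 < x → ∀ ε : ℝ, 0 < ε → ∀ η : ℝ, 0 < η → ∃ ρ : ℝ, 0 < ρ ∧
          ∀ᶠ n in atTop, (SAW.law Q.carrier (δs n) (a (δs n)) (b (δs n))).real
            {ω | ∃ γ' : CurveClass ℂ, (Q.chord 0 2 (by decide)).IsSimpleChord γ' ∧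
              dist γ' (c n ω) < ρ ∧
              ε ≤ |conformalWelding Q γ' x - conformalWelding Q (c n ω) x|} ≤ η) →
        ∀ Γ : (NNReal → ℝ) → CurveClass ℂ,
          IsSLECurve ((8 : NNReal) / 3) (Q.chord 0 2 (by decide)) Γ →
          ∀ (k : ℕ) (x : Fin k → ℝ), (∀ i, 0 < x i) →
          ∀ g : BoundedContinuousFunction (Fin k → ℝ) ℝ,
            Tendsto (fun n => ∫ ω, g (fun i => conformalWelding Q (c n ω) (x i))
                ∂(SAW.law Q.carrier (δs n) (a (δs n)) (b (δs n)))) atTop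
              (𝓝 (∫ γ, g (fun i => conformalWelding Q γ (x i)) ∂(preWienerMeasure.map Γ))) := by
  intro Q a b hab δs hpos hδ c' hc' hst
  obtain ⟨c, hcS, hcd, hlaw⟩ := latticeWeldingLaw_of_sawScalingLimit' hS Q a b hab δs hpos hδ
  exact hasSLEWeldingLaw_transfer hlaw hcS hcd hc'.2 hst

/-- **`SAWScalingLimit ⟺ stmt-4982 ∧ stmt-1372 ∧ Stub A ∧ Stub B`, unconditionally**: the
`stable_proxies` cut of crux (W) is SOUND (⇒: `simpleSubseqLimits_of_sawScalingLimit`,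
`eventualTight_of_sawScalingLimit`, `stableChordProxies_of_sawScalingLimit`,
`weldingLawOfStableProxies_of_sawScalingLimit`) and COMPLETE (⇐: A ∧ B give the lattice welding
law — take the stable family and identify it — and
`sawScalingLimit_iff_simpleSubseqLimits_and_eventualTight_and_latticeWeldingLaw`). [folklore] -/
theorem sawScalingLimit_iff_stableProxiesStubs :
    _root_.SAWScalingLimit ↔
    (SAWLoopFugacityFlow.SimpleSubseqLimits ∧ SAWWeldingIdentification.EventualTight ∧
    (∀ (Q : ConformalRectangle) (a b : ℝ → Site 2),
      SAW.IsEndpointApprox (Q.chord 0 2 (by decide)) a b →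
      ∀ (δs : ℕ → ℝ), (∀ n, 0 < δs n) → Tendsto δs atTop (𝓝 0) →
      ∃ c : (n : ℕ) → SAW.DomainSAW Q.carrier (δs n) (a (δs n)) (b (δs n)) → CurveClass ℂ,
        ((∀ᶠ n in atTop, ∀ᵐ ω ∂(SAW.law Q.carrier (δs n) (a (δs n)) (b (δs n))),
            (Q.chord 0 2 (by decide)).IsSimpleChord (c n ω)) ∧
         (∀ ε : ℝ, 0 < ε →
            Tendsto (fun n => (SAW.law Q.carrier (δs n) (a (δs n)) (b (δs n))).real
              {ω | ε < dist ω.curve (c n ω)}) atTop (𝓝 0))) ∧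
        (∀ x : ℝ, 0 < x → ∀ ε : ℝ, 0 < ε → ∀ η : ℝ, 0 < η → ∃ ρ : ℝ, 0 < ρ ∧
          ∀ᶠ n in atTop, (SAW.law Q.carrier (δs n) (a (δs n)) (b (δs n))).real
            {ω | ∃ γ' : CurveClass ℂ, (Q.chord 0 2 (by decide)).IsSimpleChord γ' ∧
              dist γ' (c n ω) < ρ ∧
              ε ≤ |conformalWelding Q γ' x - conformalWelding Q (c n ω) x|} ≤ η)) ∧
    (∀ (Q : ConformalRectangle) (a b : ℝ → Site 2),
      SAW.IsEndpointApprox (Q.chord 0 2 (by decide)) a b →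
      ∀ (δs : ℕ → ℝ), (∀ n, 0 < δs n) → Tendsto δs atTop (𝓝 0) →
      ∀ c : (n : ℕ) → SAW.DomainSAW Q.carrier (δs n) (a (δs n)) (b (δs n)) → CurveClass ℂ,
        ((∀ᶠ n in atTop, ∀ᵐ ω ∂(SAW.law Q.carrier (δs n) (a (δs n)) (b (δs n))),
            (Q.chord 0 2 (by decide)).IsSimpleChord (c n ω)) ∧
         (∀ ε : ℝ, 0 < ε →
            Tendsto (fun n => (SAW.law Q.carrier (δs n) (a (δs n)) (b (δs n))).real
              {ω | ε < dist ω.curve (c n ω)}) atTop (𝓝 0))) →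
        (∀ x : ℝ, 0 < x → ∀ ε : ℝ, 0 < ε → ∀ η : ℝ, 0 < η → ∃ ρ : ℝ, 0 < ρ ∧
          ∀ᶠ n in atTop, (SAW.law Q.carrier (δs n) (a (δs n)) (b (δs n))).real
            {ω | ∃ γ' : CurveClass ℂ, (Q.chord 0 2 (by decide)).IsSimpleChord γ' ∧
              dist γ' (c n ω) < ρ ∧
              ε ≤ |conformalWelding Q γ' x - conformalWelding Q (c n ω) x|} ≤ η) →
        ∀ Γ : (NNReal → ℝ) → CurveClass ℂ,
          IsSLECurve ((8 : NNReal) / 3) (Q.chord 0 2 (by decide)) Γ →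
          ∀ (k : ℕ) (x : Fin k → ℝ), (∀ i, 0 < x i) →
          ∀ g : BoundedContinuousFunction (Fin k → ℝ) ℝ,
            Tendsto (fun n => ∫ ω, g (fun i => conformalWelding Q (c n ω) (x i))
                ∂(SAW.law Q.carrier (δs n) (a (δs n)) (b (δs n)))) atTop
              (𝓝 (∫ γ, g (fun i => conformalWelding Q γ (x i)) ∂(preWienerMeasure.map Γ))))) := by
  refine ⟨fun hS => ⟨simpleSubseqLimits_of_sawScalingLimit hS, eventualTight_of_sawScalingLimit hS,
      stableChordProxies_of_sawScalingLimit hS, weldingLawOfStableProxies_of_sawScalingLimit hS⟩,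
    fun h => ?_⟩
  obtain ⟨h1, hT, hA, hB⟩ := h
  refine sawScalingLimit_iff_simpleSubseqLimits_and_eventualTight_and_latticeWeldingLaw.2
    ⟨h1, hT, fun Q a b hab δs hpos hδ => ?_⟩
  obtain ⟨c, hc, hst⟩ := hA Q a b hab δs hpos hδ
  exact ⟨c, hc.1, hc.2, hB Q a b hab δs hpos hδ c hc hst⟩

/-- **The skeleton composition at `Theorems/` level**: stmt-4982 → Stub A → Stub B → (W)
(`WeldingLawOfLimit`, the crux BY NAME). Once `stub_stableChordProxies` and
`stub_weldingLawOfStableProxies` land (and stmt-4982 closes), the closing file is this one term.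
[folklore] -/
theorem weldingLawOfLimit_of_simpleSubseqLimits_of_stableProxies
    (h1 : SAWLoopFugacityFlow.SimpleSubseqLimits)
    (hA : ∀ (Q : ConformalRectangle) (a b : ℝ → Site 2),
      SAW.IsEndpointApprox (Q.chord 0 2 (by decide)) a b →
      ∀ (δs : ℕ → ℝ), (∀ n, 0 < δs n) → Tendsto δs atTop (𝓝 0) →
      ∃ c : (n : ℕ) → SAW.DomainSAW Q.carrier (δs n) (a (δs n)) (b (δs n)) → CurveClass ℂ,
        ((∀ᶠ n in atTop, ∀ᵐ ω ∂(SAW.law Q.carrier (δs n) (a (δs n)) (b (δs n))),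
            (Q.chord 0 2 (by decide)).IsSimpleChord (c n ω)) ∧
         (∀ ε : ℝ, 0 < ε →
            Tendsto (fun n => (SAW.law Q.carrier (δs n) (a (δs n)) (b (δs n))).real
              {ω | ε < dist ω.curve (c n ω)}) atTop (𝓝 0))) ∧
        (∀ x : ℝ, 0 < x → ∀ ε : ℝ, 0 < ε → ∀ η : ℝ, 0 < η → ∃ ρ : ℝ, 0 < ρ ∧
          ∀ᶠ n in atTop, (SAW.law Q.carrier (δs n) (a (δs n)) (b (δs n))).real
            {ω | ∃ γ' : CurveClass ℂ, (Q.chord 0 2 (by decide)).IsSimpleChord γ' ∧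
              dist γ' (c n ω) < ρ ∧
              ε ≤ |conformalWelding Q γ' x - conformalWelding Q (c n ω) x|} ≤ η))
    (hB : ∀ (Q : ConformalRectangle) (a b : ℝ → Site 2),
      SAW.IsEndpointApprox (Q.chord 0 2 (by decide)) a b →
      ∀ (δs : ℕ → ℝ), (∀ n, 0 < δs n) → Tendsto δs atTop (𝓝 0) →
      ∀ c : (n : ℕ) → SAW.DomainSAW Q.carrier (δs n) (a (δs n)) (b (δs n)) → CurveClass ℂ,
        ((∀ᶠ n in atTop, ∀ᵐ ω ∂(SAW.law Q.carrier (δs n) (a (δs n)) (b (δs n))),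
            (Q.chord 0 2 (by decide)).IsSimpleChord (c n ω)) ∧
         (∀ ε : ℝ, 0 < ε →
            Tendsto (fun n => (SAW.law Q.carrier (δs n) (a (δs n)) (b (δs n))).real
              {ω | ε < dist ω.curve (c n ω)}) atTop (𝓝 0))) →
        (∀ x : ℝ, 0 < x → ∀ ε : ℝ, 0 < ε → ∀ η : ℝ, 0 < η → ∃ ρ : ℝ, 0 < ρ ∧
          ∀ᶠ n in atTop, (SAW.law Q.carrier (δs n) (a (δs n)) (b (δs n))).real
            {ω | ∃ γ' : CurveClass ℂ, (Q.chord 0 2 (by decide)).IsSimpleChord γ' ∧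
              dist γ' (c n ω) < ρ ∧
              ε ≤ |conformalWelding Q γ' x - conformalWelding Q (c n ω) x|} ≤ η) →
        ∀ Γ : (NNReal → ℝ) → CurveClass ℂ,
          IsSLECurve ((8 : NNReal) / 3) (Q.chord 0 2 (by decide)) Γ →
          ∀ (k : ℕ) (x : Fin k → ℝ), (∀ i, 0 < x i) →
          ∀ g : BoundedContinuousFunction (Fin k → ℝ) ℝ,
            Tendsto (fun n => ∫ ω, g (fun i => conformalWelding Q (c n ω) (x i))
                ∂(SAW.law Q.carrier (δs n) (a (δs n)) (b (δs n)))) atTop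
              (𝓝 (∫ γ, g (fun i => conformalWelding Q γ (x i)) ∂(preWienerMeasure.map Γ)))) :
    SAWWeldingIdentification.WeldingLawOfLimit := by
  refine weldingLawOfLimit_of_simpleSubseqLimits_of_latticeWeldingLaw h1 fun Q a b hab δs hpos hδ => ?_
  obtain ⟨c, hc, hst⟩ := hA Q a b hab δs hpos hδ
  exact ⟨c, hc.1, hc.2, hB Q a b hab δs hpos hδ c hc hst⟩

end Summit.CriticalPhenomena.SAWScalingLimit.Theorems.WeldingLawOfLimit

end
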